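import Literature.Analysis.FluidPDE.PeriodicCylinderNeumannWallSmooth
import HarnessLib

/-!
# Patching local smooth representatives of a periodic function; the band away from the axis

Topic `Literature/Analysis/FluidPDE`. Theorem-only file (no definitions, no named facts) of the
regularity theory for the weak periodic Neumann problem on the cylinder `{r ≤ 1} × ℝ/Lℤ`
(sequel of `PeriodicCylinderNeumannWallSmooth`; the analytic input of the local existence theorem
for the Euler equations in the periodic cylinder, T. Kato, C. Y. Lai, J. Funct. Anal. **56**
(1984), Thm I/II, named fact `Literature.Analysis.FluidPDE.KatoLai1984_periodicCylinderUniformExistence`;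
regularity of the Neumann problem as in Kato–Lai §4 (i) and their reference [14, Thm 5.5.2]).

* `eqOn_of_ae_eq_of_continuousOn` — two continuous representatives of the same function on an open
  set agree there (`Measure.eqOn_open_of_ae_eq`);
* `exists_periodic_smooth_rep_of_local` — **patching**: let `U ⊆ ℝ³` be open and invariant under
  the period shift `x ↦ x + L e_z`, `Q` an `L`-periodic function and `Gp` a field such that every
  point of `U` has a ball on which `Q` agrees a.e. with a smooth function `g` and `Gp` with `∇g`.
  Then there is ONE function `qU`, `C^∞` on `U` and `L`-periodic, with `Q = qU` and `Gp = ∇qU`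
  a.e. on `U` (choose local representatives; they agree on overlaps by continuity, so the diagonal
  choice `qU x = g_x(x)` is locally one of them — `contDiffOn_of_locally_contDiffOn` — and the a.e.
  identities pass to `U` through a countable subcover, `TopologicalSpace.countable_cover_nhdsWithin`
  and `ae_restrict_biUnion_iff`; periodicity because `y ↦ g_{x+Le_z}(y + L e_z)` is again a
  continuous local representative near `x`);
* `exists_band_smooth_rep` — the instance on the band `{0.6 < r < 0.95} × ℝ` for the periodic
  extension `Q = q ∘ axialRed` of the weak Neumann potential and `Gp = ∇q ∘ axialRed`, whose local
  representatives are `exists_local_smooth_rep` of the previous file.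

Mathlib/tree search: `Measure.eqOn_open_of_ae_eq`, `contDiffOn_of_locally_contDiffOn`,
`TopologicalSpace.countable_cover_nhdsWithin`, `ae_restrict_biUnion_iff`,
`Filter.EventuallyEq.fderiv_eq`; nothing cylinder-specific existed.

## References

* T. Kato, C. Y. Lai, J. Funct. Anal. 56 (1984) 15–28, §4 (i). [KatoLai1984]
* L. C. Evans, *Partial Differential Equations*, 2nd ed. (2010), §6.3.1 (interior regularity is
  local). [Evans2010]
-/

noncomputable section

open MeasureTheory Set Function Filter Topology TopologicalSpace WithLp Metric Module
open scoped ContDiff NNReal ENNReal InnerProductSpace RealInnerProductSpace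

namespace Literature.Analysis.FluidPDE

open Literature.Analysis.FunctionSpaces

/-- Local notation for physical space `ℝ³ = EuclideanSpace ℝ (Fin 3)`. -/
local notation "ℝ³" => EuclideanSpace ℝ (Fin 3)

/-- Local notation for the closed unit cylinder `{r ≤ 1}`. -/
local notation "𝕂" => closure (SetLike.coe unitCylinder : Set (EuclideanSpace ℝ (Fin 3)))

namespace PeriodicCylinder

variable {L : ℝ}

/-! ### Coherence of continuous representatives -/

/-- **Two continuous representatives of the same function agree on the open overlap.** [folklore] -/
theorem eqOn_of_ae_eq_of_continuousOn {O : Set ℝ³} (hO : IsOpen O) {Q g₁ g₂ : ℝ³ → ℝ}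
    (h₁ : ∀ᵐ x ∂(volume.restrict O), Q x = g₁ x) (h₂ : ∀ᵐ x ∂(volume.restrict O), Q x = g₂ x)
    (hg₁ : ContinuousOn g₁ O) (hg₂ : ContinuousOn g₂ O) : EqOn g₁ g₂ O := by
  have hae : g₁ =ᵐ[volume.restrict O] g₂ := by
    filter_upwards [h₁, h₂] with x hx1 hx2
    rw [← hx1, hx2]
  exact Measure.eqOn_open_of_ae_eq hae hO hg₁ hg₂

/-! ### Patching local smooth representatives -/

/-- **Patching local smooth representatives of a periodic function.** Let `U` be open and invariant
under the period shift, `Q` `L`-periodic, and suppose every `x ∈ U` has a ball `B(x, 2ρ₀)` and a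
function `g` smooth on it with `Q = g` and `Gp = ∇g` a.e. on the ball. Then there is `qU`, `C^∞` on
`U` and `L`-periodic, with `Q = qU` and `Gp = ∇qU` a.e. on `U`. [folklore] -/
theorem exists_periodic_smooth_rep_of_local (hL : 0 < L) {U : Set ℝ³} (hUo : IsOpen U)
    (hUper : ∀ x : ℝ³, x + L • eZ ∈ U ↔ x ∈ U) {Q : ℝ³ → ℝ} {Gp : ℝ³ → ℝ³}
    (hQp : IsAxiallyPeriodic L Q)
    (hloc : ∀ x ∈ U, ∃ ρ₀ : ℝ, 0 < ρ₀ ∧ ∃ g : ℝ³ → ℝ, ContDiffOn ℝ ∞ g (ball x (2 * ρ₀)) ∧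
      (∀ᵐ y ∂(volume.restrict (ball x (2 * ρ₀))), Q y = g y) ∧
      (∀ᵐ y ∂(volume.restrict (ball x (2 * ρ₀))), Gp y = gradient g y)) :
    ∃ qU : ℝ³ → ℝ, ContDiffOn ℝ ∞ qU U ∧ IsAxiallyPeriodic L qU ∧
      (∀ᵐ x ∂(volume.restrict U), Q x = qU x) ∧
      (∀ᵐ x ∂(volume.restrict U), Gp x = gradient qU x) := by
  classical
  have _hL := hL
  choose! ρ hρ g hg hQg hGg using hloc
  -- the representative
  set qU : ℝ³ → ℝ := fun x => if x ∈ U then g x x else 0 with hqU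
  -- coherence: near `x₀ ∈ U`, `qU = g x₀`
  have hcoh : ∀ x₀ ∈ U, ∀ x ∈ ball x₀ (ρ x₀) ∩ U, qU x = g x₀ x := fun x₀ hx₀ x hx => by
    have hxU : x ∈ U := hx.2
    simp only [hqU, if_pos hxU]
    -- both `g x` and `g x₀` are continuous representatives on the open overlap containing `x`
    set O : Set ℝ³ := ball x (2 * ρ x) ∩ ball x₀ (2 * ρ x₀) with hO
    have hOo : IsOpen O := isOpen_ball.inter isOpen_ball
    have hxO : x ∈ O := ⟨mem_ball_self (by linarith [hρ x hxU]), by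
      have := hx.1; rw [mem_ball] at this ⊢; linarith [hρ x₀ hx₀]⟩
    have e := eqOn_of_ae_eq_of_continuousOn hOo
      (ae_restrict_of_ae_restrict_of_subset inter_subset_left (hQg x hxU))
      (ae_restrict_of_ae_restrict_of_subset inter_subset_right (hQg x₀ hx₀))
      ((hg x hxU).continuousOn.mono inter_subset_left) ((hg x₀ hx₀).continuousOn.mono inter_subset_right)
    exact e hxO
  -- smoothness on `U`
  have hsmooth : ContDiffOn ℝ ∞ qU U := by
    refine contDiffOn_of_locally_contDiffOn fun x₀ hx₀ => ⟨ball x₀ (ρ x₀), isOpen_ball, mem_ball_self (hρ x₀ hx₀), ?_⟩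
    have hsub : U ∩ ball x₀ (ρ x₀) ⊆ ball x₀ (2 * ρ x₀) := fun x hx => by
      have := hx.2; rw [mem_ball] at this ⊢; linarith [hρ x₀ hx₀]
    exact ((hg x₀ hx₀).mono hsub).congr fun x hx => hcoh x₀ hx₀ x ⟨hx.2, hx.1⟩
  -- a countable subcover by the small balls
  obtain ⟨T, hTU, hTc, hcover⟩ := TopologicalSpace.countable_cover_nhdsWithin (s := U)
    (f := fun x => ball x (ρ x) ∩ U) fun x hx =>
      Filter.inter_mem (mem_nhdsWithin_of_mem_nhds (isOpen_ball.mem_nhds (mem_ball_self (hρ x hx))))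
        self_mem_nhdsWithin
  have hae_of_local : ∀ {P : ℝ³ → Prop}, (∀ x₀ ∈ U, ∀ᵐ x ∂(volume.restrict (ball x₀ (ρ x₀) ∩ U)), P x) →
      ∀ᵐ x ∂(volume.restrict U), P x := fun {P} hP => by
    have h1 : ∀ᵐ x ∂(volume.restrict (⋃ x₀ ∈ T, ball x₀ (ρ x₀) ∩ U)), P x :=
      (ae_restrict_biUnion_iff _ hTc P).2 fun x₀ hx₀ => hP x₀ (hTU hx₀)
    exact ae_restrict_of_ae_restrict_of_subset hcover h1
  refine ⟨qU, hsmooth, ?_, ?_, ?_⟩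
  · -- periodicity
    intro x
    change qU (x + L • eZ) = qU x
    by_cases hxU : x ∈ U
    · have hxU' : x + L • eZ ∈ U := (hUper x).2 hxU
      -- `y ↦ g (x + L e_z) (y + L e_z)` is a continuous representative of `Q` near `x`
      set x' := x + L • eZ with hx'
      have hper : ∀ y, Q (y + L • eZ) = Q y := fun y => hQp y
      set O : Set ℝ³ := ball x (2 * ρ x) ∩ (fun y => y + L • eZ) ⁻¹' ball x' (2 * ρ x') with hO
      have hOo : IsOpen O := isOpen_ball.inter (isOpen_ball.preimage (continuous_id.add continuous_const))
      have hxO : x ∈ O := ⟨mem_ball_self (by linarith [hρ x hxU]), by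
        show x + L • eZ ∈ ball x' (2 * ρ x'); rw [hx']; exact mem_ball_self (by linarith [hρ _ hxU'])⟩
      have h2 : ∀ᵐ y ∂(volume.restrict O), Q y = g x' (y + L • eZ) := by
        have h := hQg x' hxU'
        -- transport along `y ↦ y + L e_z`
        have ht := ae_restrict_comp_sub_of_ae_restrict isOpen_ball.measurableSet (-(L • eZ)) h
        simp only [sub_neg_eq_add] at ht
        refine ae_restrict_of_ae_restrict_of_subset (fun y hy => hy.2) ?_
        filter_upwards [ht] with y hy
        rw [← hper y, hy]
      have e := eqOn_of_ae_eq_of_continuousOn hOo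
        (ae_restrict_of_ae_restrict_of_subset inter_subset_left (hQg x hxU)) h2
        ((hg x hxU).continuousOn.mono inter_subset_left)
        (((hg x' hxU').continuousOn.comp (continuous_id.add continuous_const).continuousOn fun y hy => hy.2))
      simp only [hqU, if_pos hxU, if_pos hxU']
      exact (e hxO).symm
    · have hxU' : x + L • eZ ∉ U := fun h => hxU ((hUper x).1 h)
      simp only [hqU, if_neg hxU, if_neg hxU']
  · -- `Q = qU` a.e. on `U`
    refine hae_of_local fun x₀ hx₀ => ?_
    have h1 : ∀ᵐ x ∂(volume.restrict (ball x₀ (ρ x₀) ∩ U)), Q x = g x₀ x :=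
      ae_restrict_of_ae_restrict_of_subset (fun x hx => by
        have := hx.1; rw [mem_ball] at this ⊢; linarith [hρ x₀ hx₀]) (hQg x₀ hx₀)
    have h2 : ∀ᵐ x ∂(volume.restrict (ball x₀ (ρ x₀) ∩ U)), x ∈ ball x₀ (ρ x₀) ∩ U :=
      ae_restrict_mem (isOpen_ball.inter hUo).measurableSet
    filter_upwards [h1, h2] with x hx1 hx2
    rw [hx1, hcoh x₀ hx₀ x hx2]
  · -- `Gp = ∇qU` a.e. on `U`
    refine hae_of_local fun x₀ hx₀ => ?_
    have h1 : ∀ᵐ x ∂(volume.restrict (ball x₀ (ρ x₀) ∩ U)), Gp x = gradient (g x₀) x :=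
      ae_restrict_of_ae_restrict_of_subset (fun x hx => by
        have := hx.1; rw [mem_ball] at this ⊢; linarith [hρ x₀ hx₀]) (hGg x₀ hx₀)
    have h2 : ∀ᵐ x ∂(volume.restrict (ball x₀ (ρ x₀) ∩ U)), x ∈ ball x₀ (ρ x₀) ∩ U :=
      ae_restrict_mem (isOpen_ball.inter hUo).measurableSet
    filter_upwards [h1, h2] with x hx1 hx2
    rw [hx1, gradient, gradient]
    congr 1
    -- `qU = g x₀` on the open set `ball x₀ (ρ x₀) ∩ U` around `x`
    refine (Filter.EventuallyEq.fderiv_eq ?_).symm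
    filter_upwards [(isOpen_ball.inter hUo).mem_nhds hx2] with y hy
    exact hcoh x₀ hx₀ y hy

/-! ### The band away from the axis -/

/-- **A smooth `L`-periodic representative of the periodic extension of the potential on the band
`{0.6 < r < 0.95} × ℝ`**: for the weak Neumann solution `∇q[h₀,h₁]` with smooth periodic data
(`∫_cell h₀ = 0`) there is `qU : ℝ³ → ℝ`, `C^∞` on the open band, `L`-periodic, with
`q ∘ axialRed = qU` and `∇q ∘ axialRed = ∇qU` a.e. on the band (patch the local smooth
representatives `exists_local_smooth_rep`). [folklore] -/
theorem exists_band_smooth_rep (hL : 0 < L) {h₀ : ℝ³ → ℝ} {h₁ : ℝ³ → ℝ³} (hh₀ : IsSmoothPeriodic L h₀)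
    (hh₁ : IsSmoothPeriodic L h₁) (hmean : ∫ x in (cylinderCell L : Set ℝ³), h₀ x = 0) :
    ∃ qU : ℝ³ → ℝ, ContDiffOn ℝ ∞ qU {x : ℝ³ | 0.6 < cylRadius x ∧ cylRadius x < 0.95} ∧
      IsAxiallyPeriodic L qU ∧
      (∀ᵐ x ∂(volume.restrict {x : ℝ³ | 0.6 < cylRadius x ∧ cylRadius x < 0.95}),
        ((potential (neumannGrad L (toCell L h₀) (toCell L h₁)) : Lp ℝ 2 (cellMeasure L)) : ℝ³ → ℝ) (axialRed L x) = qU x) ∧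
      (∀ᵐ x ∂(volume.restrict {x : ℝ³ | 0.6 < cylRadius x ∧ cylRadius x < 0.95}),
        ((((neumannGrad L (toCell L h₀) (toCell L h₁) : gradSpace L) : Lp ℝ³ 2 (cellMeasure L)) : ℝ³ → ℝ³))
          (axialRed L x) = gradient qU x) := by
  have hUo : IsOpen {x : ℝ³ | 0.6 < cylRadius x ∧ cylRadius x < 0.95} :=
    (isOpen_lt continuous_const continuous_cylRadius).inter (isOpen_lt continuous_cylRadius continuous_const)
  have hUper : ∀ x : ℝ³, x + L • eZ ∈ {x : ℝ³ | 0.6 < cylRadius x ∧ cylRadius x < 0.95} ↔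
      x ∈ {x : ℝ³ | 0.6 < cylRadius x ∧ cylRadius x < 0.95} := fun x => by
    simp only [mem_setOf_eq, cylRadius_add_smul_eZ]
  have hQp : IsAxiallyPeriodic L fun x =>
      ((potential (neumannGrad L (toCell L h₀) (toCell L h₁)) : Lp ℝ 2 (cellMeasure L)) : ℝ³ → ℝ) (axialRed L x) :=
    fun x => by
      change _ = ((potential (neumannGrad L (toCell L h₀) (toCell L h₁)) : Lp ℝ 2 (cellMeasure L)) : ℝ³ → ℝ) (axialRed L x)
      rw [← axialRed_add_period hL x]
      rfl
  exact exists_periodic_smooth_rep_of_local hL hUo hUper hQp fun x hx =>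
    exists_local_smooth_rep hL hh₀ hh₁ hmean hx.1 hx.2

end PeriodicCylinder

end Literature.Analysis.FluidPDE
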